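import Summits.CriticalPhenomena.PercolationContinuityZ3.Theorems.Transplant.HexShadowVSurgeryAtt
import Summits.CriticalPhenomena.PercolationContinuityZ3.Theorems.Transplant.HexShadowBlocks
import HarnessLib

/-!
# HEXAGONAL SHADOWS L — located surgery outputs with a general ATTACHMENT RADIUS: `SurgOutR Γ r ω z ω'`

builds on p205010 (kernel theorem, internal audit signed; external expert review pending) — NOT used in this file.  Lane `prim-bschramm`, seat
`prim-bschramm-p2` (gen 39; class C1b; memo `HOME/bschramm/P2-LATTICES.md` §136 (11),(13), §137); helper file (`--supports stmt-CriticalPhenomena-4575 --as helper`).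

WHY.  «HexShadowSurgOut»'s `HexShadow.SurgOut Γ r ω z ω'` fixes the attachment radius: `Att(ω') ⊆ \overline{hexBall z 3}`.  A vertex-set surgery whose cleared
set `W` lies over `hexBall z R` with `R ≥ 4` (the `(111)`-film of thickness `3` needs surgery radius `4`: «Slab111SK4FinalK3») has `Att(ω') ⊆ W` over
`hexBall z R` only.  This file is the radius-generic interface the Lemma-7 bookkeeping consumes:
* §1 two hexagon lemmas at general radii in linear form (`mem_hexBall_add_of_mem`, `hexBall_subset_hexBall_add`);
* §2 **`HexShadow.SurgOutR Γ r ω z ω'`** — `ω' ∈ C`; `ω' ⊆ ω ∪ (E(G) ∩ window pairs)`; `ω'` agrees with `ω` off the pairs touching `\overline{hexBall z r}`;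
  `Att(ω') ≠ ∅` lies over `hexBall z r` —, its monotonicity in `r`, `SurgOut Γ r ⇒ SurgOutR Γ r` for `r ≥ 3`, and **`VSurgery.surgOutR`**: a vertex-set surgery with
  `W ⊆ \overline{hexBall z r}` is such an output.
[cite: DuminilCopinSidoraviciusTassion2016, §2.3 (proof of Fact 2, pp. 6–7)]
-/

noncomputable section

namespace Summit.CriticalPhenomena.PercolationContinuityZ3.Theorems.Transplant

open MeasureTheory Literature.Probability.Percolation Literature.Probability.LatticeModels SimpleGraph Filter
open scoped Classical Topology

/-! ## §1 Hexagons at general radii -/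

/-- Two centres whose hexagons of radii `r`, `r'` share a point are at `triNorm`-distance `≤ r + r'`. [folklore] -/
theorem mem_hexBall_add_of_mem {z z' q : Site 2} {r r' : ℕ} (hq : q ∈ hexBall z r) (hq' : q ∈ hexBall z' r') : z' ∈ hexBall z (r + r') := by
  rw [mem_hexBall_iff_lin] at hq hq' ⊢
  push_cast
  omega

/-- A hexagon of radius `r'` about `z` lies in the hexagon of radius `r' + r` about any point of `hexBall z r`. [folklore] -/
theorem hexBall_subset_hexBall_add {z q : Site 2} {r : ℕ} (hq : q ∈ hexBall z r) (r' : ℕ) : hexBall z r' ⊆ hexBall q (r' + r) := by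
  intro w hw
  rw [mem_hexBall_iff_lin] at hq hw ⊢
  push_cast
  omega

namespace HexShadow

variable {V : Type} {G : SimpleGraph V} (Φ : HexShadow G) [Countable V]

/-! ## §2 Located surgery outputs with attachment radius `r` -/

/-- **The output of one recoverable local surgery of `ω` located at `z ∈ 𝕋`, surgery AND attachment radius `r`** (what the proof of Fact 2 uses of DST's
`ω^{(z)}` when the surgery ball is `\overline{B_R(z)}` with `R = r`): `ω' ∈ C`; `ω'` consists of edges of `ω` and lattice edges over the window; `ω'` agrees with
`ω` off the pairs touching `\overline{hexBall z r}`; `Att(ω') ≠ ∅` lies over `hexBall z r`.  («HexShadowSurgOut»'s `SurgOut` is the case "attachment radius `3`".)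
[cite: DuminilCopinSidoraviciusTassion2016, §2.3, proof of Fact 2 (pp. 6–7)] -/
structure SurgOutR (Γ : GlueData) (r : ℕ) (ω : BondConfig V) (z : Site 2) (ω' : BondConfig V) : Prop where
  /-- the new configuration realises `C` -/
  mem_evC : ω' ∈ Φ.evC Γ
  /-- it consists of old edges and lattice edges of the window -/
  subset_window : ω' ⊆ ω ∪ (G.edgeSet ∩ (Φ.lift (Φ.big Γ ∪ Φ.small Γ)).sym2)
  /-- it agrees with `ω` off the pairs touching `\overline{hexBall z r}` -/
  agree_off : ∀ e, e ∉ Φ.touch (hexBall z r) → (e ∈ ω' ↔ e ∈ ω)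
  /-- the attachment statistic is non-empty -/
  att_nonempty : (Φ.att Γ ω').Nonempty
  /-- and lies over `hexBall z r` -/
  att_near : ∀ q ∈ Φ.att Γ ω', Φ.sh q ∈ hexBall z r

/-- Enlarging the radius. [folklore] -/
theorem SurgOutR.mono {Γ : GlueData} {r r' : ℕ} (hr : r ≤ r') {ω ω' : BondConfig V} {z : Site 2} (h : Φ.SurgOutR Γ r ω z ω') :
    Φ.SurgOutR Γ r' ω z ω' where
  mem_evC := h.mem_evC
  subset_window := h.subset_window
  agree_off := fun e he => h.agree_off e fun he' => he (Φ.touch_mono (hexBall_mono z hr) he')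
  att_nonempty := h.att_nonempty
  att_near := fun q hq => hexBall_mono z hr (h.att_near q hq)

/-- A located output of «HexShadowSurgOut» with radius `r ≥ 3` is a located output with attachment radius `r`. [folklore] -/
theorem SurgOut.surgOutR {Γ : GlueData} {r : ℕ} (hr : 3 ≤ r) {ω ω' : BondConfig V} {z : Site 2} (h : Φ.SurgOut Γ r ω z ω') :
    Φ.SurgOutR Γ r ω z ω' where
  mem_evC := h.mem_evC
  subset_window := h.subset_window
  agree_off := h.agree_off
  att_nonempty := h.att_nonempty
  att_near := fun q hq => hexBall_mono z hr (h.att_near q hq)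

variable {Φ}

/-- **A vertex-set surgery with `W ⊆ \overline{hexBall z r}` is a recoverable located surgery with attachment radius `r`** (for `ω ∈ 𝒳`): the interface of the
radius-generic reduction «HexShadowFact2ReductionR». [cite: DuminilCopinSidoraviciusTassion2016, §2.3, proof of Fact 2 (pp. 6–7)] -/
theorem VSurgery.surgOutR {Γ : GlueData} {ω : BondConfig V} (sg : Φ.VSurgery Γ ω) (hX : ω ∈ Φ.evX Γ) {z : Site 2} {r : ℕ}
    (hWr : sg.W ⊆ Φ.lift (hexBall z r)) : Φ.SurgOutR Γ r ω z sg.newConfig where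
  mem_evC := sg.newConfig_mem_evC hX
  subset_window := fun e he => by
    rcases sg.mem_window_of_mem_newConfig hX.1.1.1 he with h | ⟨h1, h2⟩
    · exact Or.inl h
    · exact Or.inr ⟨h1, h2⟩
  agree_off := fun e he => sg.mem_newConfig_iff_of_not_touch fun h => he (HexShadow.touchV_subset_touch Φ hWr h)
  att_nonempty := sg.att_nonempty hX
  att_near := fun q hq => by
    have := hWr (sg.att_subset hX hq)
    rwa [HexShadow.mem_lift] at this

end HexShadow

end Summit.CriticalPhenomena.PercolationContinuityZ3.Theorems.Transplant

end
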